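import Summits.RiemannHypothesis.RiemannHypothesis.Theorems.SoloInformedGroundStateDipole
import Mathlib.Analysis.Fourier.AddCircle

/-!
# Fence invisibility: below the resolving window a vertical fence of reflected off-line pairs is
# exactly as positive as critical zeros

(solo RiemannHypothesis/informed, session 4 — the rigorous "resolution bound" half of the
visibility analysis; memo `paper/sharpest.md` §2e (D7).)

In the defect identity `Re Q_T(g) = Z_T(g) − D_T(g)/2` (`re_weilZeroSidePartial_weilQuadratic_eq`)
a reflected pair `{ρ, ρ* = 1 − ρ̄}` of common multiplicity `m` contributes the **pair block**
`m·(|ĝ(ρ)|² + |ĝ(ρ*)|² − |ĝ(ρ) − ĝ(ρ*)|²) = 2m·Re(ĝ(ρ)·conj ĝ(ρ*))`, of either sign — this is what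
makes a single off-line pair visible to an odd dipole (`weilGroundEnergy_le_of_oddDipole`).

This file proves that the sign information disappears completely for a **vertical fence** of
pairs `ρ_k = ½ + u + i(γ₀ + 2πk/T)`, `k ∈ ℤ`, at ANY common offset `u`, as soon as the test
function does not resolve the spacing: for `g(t) = h(t)e^{−iγ₀t}` with `h` continuous,
`supp h ⊆ [−a, a]` and `2a < T`,

* `Σ_k Re(ĝ(ρ_k)·conj ĝ(ρ_k*)) = T·‖h‖₂²`                       (`hasSum_re_weilMellin_pair_fence`),
* `Σ_k |ĝ(½ + i(γ₀ + 2πk/T))|² = T·‖h‖₂²`                       (`hasSum_norm_sq_weilMellin_fence`),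
* hence `Σ_k (|ĝ(ρ_k)|² + |ĝ(ρ_k*)|² − |ĝ(ρ_k) − ĝ(ρ_k*)|²) = 2T‖h‖₂² = 2·Σ_k |ĝ(½ + i(γ₀+2πk/T))|²`
  (`hasSum_pairBlock_fence`, `tsum_pairBlock_fence_eq_two_mul_tsum_critical`):

the fence contributes to `Z − D/2` exactly what DOUBLE CRITICAL ZEROS at the same heights would,
for every such test function and every offset `u` — it is invisible to the Weil form at windows
`a < T/2`.  The proof is Parseval on the period interval `(−T/2, T/2]`
(`hasSum_sq_fourierCoeffOn`) for `h·e^{ut} ± h·e^{−ut}` and the polarization identity; no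
property of `ζ` is used.  Consequences for what positivity criteria can detect are drawn in the
memo: an off-line zero is certified by the ground energy only at windows that RESOLVE it from
same-offset neighbours (`a ≳ π/Δ` for height spacing `Δ`), in addition to the height threshold of
the single-pair analysis.
-/

open Complex MeasureTheory Set Filter
open Literature.NumberTheory.LFunctions
open scoped ComplexConjugate Real

namespace Summit.RiemannHypothesis.RiemannHypothesis.Theorems

section Fence

variable {h : ℝ → ℂ} {a T : ℝ}

/-! ### Elementary identities -/

/-- Polarization: `Re(z·w̄) = (|z + w|² − |z − w|²)/4`. -/
theorem re_mul_conj_eq_norm_sq (z w : ℂ) :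
    (z * conj w).re = (‖z + w‖ ^ 2 - ‖z - w‖ ^ 2) / 4 := by
  rw [Complex.sq_norm, Complex.sq_norm, Complex.normSq_add, Complex.normSq_sub]
  ring

/-- The pair block in terms of `Re(z·w̄)`: `|z|² + |w|² − |z − w|² = 2·Re(z·w̄)`. -/
theorem norm_sq_add_norm_sq_sub_norm_sq_sub (z w : ℂ) :
    ‖z‖ ^ 2 + ‖w‖ ^ 2 - ‖z - w‖ ^ 2 = 2 * (z * conj w).re := by
  rw [Complex.sq_norm, Complex.sq_norm, Complex.sq_norm, Complex.normSq_sub]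
  ring

/-- The reflection `ρ ↦ 1 − ρ̄` flips the offset and keeps the height. -/
theorem one_sub_conj_half_add (u v : ℝ) :
    1 - conj ((1 : ℂ) / 2 + u + v * I) = 1 / 2 + ((-u : ℝ) : ℂ) + v * I := by
  simp only [map_add, map_mul, map_div₀, map_one, map_ofNat, Complex.conj_ofReal, Complex.conj_I,
    Complex.ofReal_neg]
  ring

/-- The Weil transform of the twisted test `h·e^{−iγ₀t}` at `½ + u + i(γ₀ + θ)` is the
`θ`-Fourier coefficient of `h·e^{ut}`. -/
theorem weilMellin_twist_eq_integral (h : ℝ → ℂ) (u γ₀ θ : ℝ) :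
    weilMellin (fun t ↦ h t * cexp (-(γ₀ * I) * t)) (1 / 2 + u + ((γ₀ + θ : ℝ) : ℂ) * I) =
      ∫ t : ℝ, cexp (θ * I * t) * (h t * cexp (u * t)) := by
  rw [weilMellin_mul_cexp]
  unfold weilMellin
  congr 1
  ext t
  rw [show cexp ((θ : ℂ) * I * t) * (h t * cexp ((u : ℂ) * t)) =
      h t * (cexp ((u : ℂ) * t) * cexp ((θ : ℂ) * I * t)) by ring, ← Complex.exp_add]
  congr 2
  push_cast
  ring

/-! ### Parseval on the period interval -/

/-- For `F` supported in `(−T/2, T/2]`, `∫ F(t)e^{2πikt/T} dt = T·ĉ_{−k}(F)` (Fourier coefficient on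
the period interval). -/
theorem integral_cexp_mul_eq_mul_fourierCoeffOn {F : ℝ → ℂ} {T : ℝ} (hT : 0 < T)
    (hF0 : Function.support F ⊆ Ioc (-(T / 2)) (T / 2)) (k : ℤ) :
    ∫ t : ℝ, cexp ((2 * π * k / T : ℝ) * I * t) * F t =
      (T : ℂ) * fourierCoeffOn (show -(T / 2) < T / 2 by linarith) F (-k) := by
  rw [fourierCoeffOn_eq_integral, neg_neg, Complex.real_smul]
  have hsupp : Function.support (fun x : ℝ ↦ fourier k (x : AddCircle (T / 2 - -(T / 2))) • F x) ⊆
      Ioc (-(T / 2)) (T / 2) := by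
    intro x hx
    apply hF0
    rw [Function.mem_support] at hx ⊢
    intro hFx
    exact hx (by rw [hFx, smul_zero])
  rw [intervalIntegral.integral_eq_integral_of_support_subset hsupp]
  have hTT : (1 / (T / 2 - -(T / 2)) : ℝ) = T⁻¹ := by
    rw [show T / 2 - -(T / 2) = T by ring, one_div]
  rw [hTT, ← mul_assoc, Complex.ofReal_inv, mul_inv_cancel₀ (Complex.ofReal_ne_zero.mpr hT.ne'),
    one_mul]
  congr 1
  ext x
  rw [fourier_coe_apply, smul_eq_mul]
  congr 2
  push_cast
  ring

/-- Parseval for the samples `∫ F(t)e^{2πikt/T} dt`, `k ∈ ℤ`, of a continuous `F` supported in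
`(−T/2, T/2]`: `Σ_k |∫ F e^{2πikt/T}|² = T·∫|F|²`. -/
theorem hasSum_norm_sq_integral_cexp_mul {F : ℝ → ℂ} {T : ℝ} (hT : 0 < T) (hF : Continuous F)
    (hFc : HasCompactSupport F) (hF0 : Function.support F ⊆ Ioc (-(T / 2)) (T / 2)) :
    HasSum (fun k : ℤ ↦ ‖∫ t : ℝ, cexp ((2 * π * k / T : ℝ) * I * t) * F t‖ ^ 2)
      (T * ∫ t : ℝ, ‖F t‖ ^ 2) := by
  have hab : -(T / 2) < T / 2 := by linarith
  have hL2 : MemLp F 2 (volume.restrict (Ioc (-(T / 2)) (T / 2))) :=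
    (hF.memLp_of_hasCompactSupport hFc).restrict _
  have hP := hasSum_sq_fourierCoeffOn hab hL2
  have hsupp2 : Function.support (fun x : ℝ ↦ ‖F x‖ ^ 2) ⊆ Ioc (-(T / 2)) (T / 2) := by
    intro x hx
    apply hF0
    rw [Function.mem_support] at hx ⊢
    intro hFx
    apply hx
    rw [hFx, norm_zero, zero_pow two_ne_zero]
  rw [intervalIntegral.integral_eq_integral_of_support_subset hsupp2,
    show T / 2 - -(T / 2) = T by ring, smul_eq_mul] at hP
  have hP2 := hP.mul_left (T ^ 2)
  have hval : T ^ 2 * (T⁻¹ * ∫ t : ℝ, ‖F t‖ ^ 2) = T * ∫ t : ℝ, ‖F t‖ ^ 2 := by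
    rw [← mul_assoc, pow_two, mul_assoc T T T⁻¹, mul_inv_cancel₀ hT.ne', mul_one]
  rw [hval] at hP2
  have hP3 := (Equiv.hasSum_iff (Equiv.neg ℤ)).mpr hP2
  have e : (fun k : ℤ ↦ ‖∫ t : ℝ, cexp ((2 * π * k / T : ℝ) * I * t) * F t‖ ^ 2) =
      (fun i : ℤ ↦ T ^ 2 * ‖fourierCoeffOn hab F i‖ ^ 2) ∘ ⇑(Equiv.neg ℤ) := by
    funext k
    rw [Function.comp_apply, Equiv.neg_apply, integral_cexp_mul_eq_mul_fourierCoeffOn hT hF0 k, norm_mul,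
      Complex.norm_real, Real.norm_eq_abs, mul_pow, sq_abs]
  rw [e]
  exact hP3

/-- Polarized Parseval for the samples: `Σ_k Re((∫ F e_k)(conj ∫ G e_k)) = T·∫ Re(F·Ḡ)`. -/
theorem hasSum_re_integral_mul_conj_integral {F G : ℝ → ℂ} {T : ℝ} (hT : 0 < T)
    (hF : Continuous F) (hFc : HasCompactSupport F) (hF0 : Function.support F ⊆ Ioc (-(T / 2)) (T / 2))
    (hG : Continuous G) (hGc : HasCompactSupport G) (hG0 : Function.support G ⊆ Ioc (-(T / 2)) (T / 2)) :
    HasSum (fun k : ℤ ↦ ((∫ t : ℝ, cexp ((2 * π * k / T : ℝ) * I * t) * F t) *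
        conj (∫ t : ℝ, cexp ((2 * π * k / T : ℝ) * I * t) * G t)).re)
      (T * ∫ t : ℝ, (F t * conj (G t)).re) := by
  have hsA : Function.support (fun t ↦ F t + G t) ⊆ Ioc (-(T / 2)) (T / 2) := by
    intro x hx
    rw [Function.mem_support] at hx
    by_cases hFx : F x = 0
    · have hGx : G x ≠ 0 := by
        intro hGx; apply hx; rw [hFx, hGx, add_zero]
      exact hG0 hGx
    · exact hF0 hFx
  have hsB : Function.support (fun t ↦ F t - G t) ⊆ Ioc (-(T / 2)) (T / 2) := by
    intro x hx
    rw [Function.mem_support] at hx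
    by_cases hFx : F x = 0
    · have hGx : G x ≠ 0 := by
        intro hGx; apply hx; rw [hFx, hGx, sub_zero]
      exact hG0 hGx
    · exact hF0 hFx
  have hA := hasSum_norm_sq_integral_cexp_mul (F := fun t ↦ F t + G t) hT (hF.add hG) (hFc.add hGc) hsA
  have hB := hasSum_norm_sq_integral_cexp_mul (F := fun t ↦ F t - G t) hT (hF.sub hG) (hFc.sub hGc) hsB
  have hint : ∀ (k : ℤ) (H : ℝ → ℂ), Continuous H → HasCompactSupport H →
      Integrable (fun t : ℝ ↦ cexp ((2 * π * k / T : ℝ) * I * t) * H t) := by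
    intro k H hH hHc
    apply Continuous.integrable_of_hasCompactSupport
    · exact (Complex.continuous_exp.comp (by fun_prop)).mul hH
    · exact hHc.mul_left
  have hS := (hA.sub hB).div_const 4
  have e1 : (fun k : ℤ ↦ ((∫ t : ℝ, cexp ((2 * π * k / T : ℝ) * I * t) * F t) *
        conj (∫ t : ℝ, cexp ((2 * π * k / T : ℝ) * I * t) * G t)).re) =
      fun k : ℤ ↦ (‖∫ t : ℝ, cexp ((2 * π * k / T : ℝ) * I * t) * (F t + G t)‖ ^ 2 -
          ‖∫ t : ℝ, cexp ((2 * π * k / T : ℝ) * I * t) * (F t - G t)‖ ^ 2) / 4 := by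
    funext k
    rw [re_mul_conj_eq_norm_sq]
    simp only [mul_add, mul_sub]
    rw [integral_add (hint k F hF hFc) (hint k G hG hGc),
      integral_sub (hint k F hF hFc) (hint k G hG hGc)]
  have hi1 : Integrable (fun t : ℝ ↦ ‖F t + G t‖ ^ 2) :=
    ((hF.add hG).memLp_of_hasCompactSupport (hFc.add hGc)).integrable_norm_pow two_ne_zero
  have hi2 : Integrable (fun t : ℝ ↦ ‖F t - G t‖ ^ 2) :=
    ((hF.sub hG).memLp_of_hasCompactSupport (hFc.sub hGc)).integrable_norm_pow two_ne_zero
  have hpt : (fun t : ℝ ↦ ‖F t + G t‖ ^ 2 - ‖F t - G t‖ ^ 2) =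
      fun t : ℝ ↦ (4 : ℝ) • (F t * conj (G t)).re := by
    funext t
    rw [re_mul_conj_eq_norm_sq, smul_eq_mul]
    ring
  have e2 : ((T * ∫ t : ℝ, ‖F t + G t‖ ^ 2) - T * ∫ t : ℝ, ‖F t - G t‖ ^ 2) / 4 =
      T * ∫ t : ℝ, (F t * conj (G t)).re := by
    rw [← mul_sub, ← integral_sub hi1 hi2, hpt, integral_smul, smul_eq_mul]
    ring
  rw [e1, ← e2]
  exact hS

/-! ### The fence theorems -/

/-- **Fence identity.** For `h` continuous with `supp h ⊆ [−a, a]`, `2a < T`, the twisted test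
`g = h·e^{−iγ₀t}` and the fence `ρ_k = ½ + u + i(γ₀ + 2πk/T)` (`k ∈ ℤ`) at ANY offset `u`:
`Σ_k Re(ĝ(ρ_k)·conj ĝ(1 − ρ̄_k)) = T·∫|h|²` — independent of `u`. -/
theorem hasSum_re_weilMellin_pair_fence (hh : Continuous h) (hsupp : tsupport h ⊆ Icc (-a) a)
    (hT : 0 < T) (haT : 2 * a < T) (u γ₀ : ℝ) :
    HasSum (fun k : ℤ ↦
      (weilMellin (fun t ↦ h t * cexp (-(γ₀ * I) * t))
          (1 / 2 + u + ((γ₀ + 2 * π * k / T : ℝ) : ℂ) * I) *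
        conj (weilMellin (fun t ↦ h t * cexp (-(γ₀ * I) * t))
          (1 - conj (1 / 2 + u + ((γ₀ + 2 * π * k / T : ℝ) : ℂ) * I)))).re)
      (T * ∫ t : ℝ, ‖h t‖ ^ 2) := by
  have hhc : HasCompactSupport h := isCompact_Icc.of_isClosed_subset (isClosed_tsupport h) hsupp
  have hh0 : Function.support h ⊆ Ioc (-(T / 2)) (T / 2) := by
    intro x hx
    have hx' := hsupp (subset_tsupport _ hx)
    exact ⟨by linarith [hx'.1], by linarith [hx'.2]⟩
  have hsF : ∀ w : ℝ, Function.support (fun t : ℝ ↦ h t * cexp ((w : ℂ) * t)) ⊆ Ioc (-(T / 2)) (T / 2) := by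
    intro w x hx
    apply hh0
    rw [Function.mem_support] at hx ⊢
    intro h0
    exact hx (by rw [h0, zero_mul])
  have hcF : ∀ w : ℝ, Continuous fun t : ℝ ↦ h t * cexp ((w : ℂ) * t) :=
    fun w ↦ hh.mul (Complex.continuous_exp.comp (by fun_prop))
  have hkF : ∀ w : ℝ, HasCompactSupport fun t : ℝ ↦ h t * cexp ((w : ℂ) * t) :=
    fun w ↦ hhc.mul_right
  have main := hasSum_re_integral_mul_conj_integral hT (hcF u) (hkF u) (hsF u) (hcF (-u)) (hkF (-u))
    (hsF (-u))
  have e1 : (fun k : ℤ ↦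
      (weilMellin (fun t ↦ h t * cexp (-(γ₀ * I) * t))
          (1 / 2 + u + ((γ₀ + 2 * π * k / T : ℝ) : ℂ) * I) *
        conj (weilMellin (fun t ↦ h t * cexp (-(γ₀ * I) * t))
          (1 - conj (1 / 2 + u + ((γ₀ + 2 * π * k / T : ℝ) : ℂ) * I)))).re) =
      fun k : ℤ ↦ ((∫ t : ℝ, cexp ((2 * π * k / T : ℝ) * I * t) * (h t * cexp ((u : ℂ) * t))) *
        conj (∫ t : ℝ, cexp ((2 * π * k / T : ℝ) * I * t) *
          (h t * cexp (((-u : ℝ) : ℂ) * t)))).re := by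
    ext k
    rw [one_sub_conj_half_add, weilMellin_twist_eq_integral, weilMellin_twist_eq_integral]
  have e2 : (T * ∫ t : ℝ, ((fun t : ℝ ↦ h t * cexp ((u : ℂ) * t)) t *
      conj ((fun t : ℝ ↦ h t * cexp (((-u : ℝ) : ℂ) * t)) t)).re) = T * ∫ t : ℝ, ‖h t‖ ^ 2 := by
    congr 1
    refine integral_congr_ae (Eventually.of_forall fun t ↦ ?_)
    simp only
    rw [map_mul, ← Complex.exp_conj, map_mul, Complex.conj_ofReal, Complex.conj_ofReal]
    have hexp : cexp ((u : ℂ) * t) * cexp (((-u : ℝ) : ℂ) * t) = 1 := by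
      rw [← Complex.exp_add, show ((u : ℂ) * t + ((-u : ℝ) : ℂ) * t : ℂ) = 0 by push_cast; ring,
        Complex.exp_zero]
    calc (h t * cexp ((u : ℂ) * t) * (conj (h t) * cexp (((-u : ℝ) : ℂ) * t))).re
        = ((h t * conj (h t)) * (cexp ((u : ℂ) * t) * cexp (((-u : ℝ) : ℂ) * t))).re := by
          congr 1; ring
      _ = ‖h t‖ ^ 2 := by
          rw [hexp, mul_one, Complex.mul_conj, Complex.normSq_eq_norm_sq]
          norm_cast
  rw [e1, ← e2]
  exact main

/-- **Critical comparison.** Same `h`, `T`: the critical-line samples at the fence heights satisfy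
`Σ_k |ĝ(½ + i(γ₀ + 2πk/T))|² = T·∫|h|²` (the case `u = 0`). -/
theorem hasSum_norm_sq_weilMellin_fence (hh : Continuous h) (hsupp : tsupport h ⊆ Icc (-a) a)
    (hT : 0 < T) (haT : 2 * a < T) (γ₀ : ℝ) :
    HasSum (fun k : ℤ ↦
      ‖weilMellin (fun t ↦ h t * cexp (-(γ₀ * I) * t))
          (1 / 2 + ((γ₀ + 2 * π * k / T : ℝ) : ℂ) * I)‖ ^ 2)
      (T * ∫ t : ℝ, ‖h t‖ ^ 2) := by
  have H := hasSum_re_weilMellin_pair_fence hh hsupp hT haT 0 γ₀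
  have e : (fun k : ℤ ↦
      ‖weilMellin (fun t ↦ h t * cexp (-(γ₀ * I) * t))
          (1 / 2 + ((γ₀ + 2 * π * k / T : ℝ) : ℂ) * I)‖ ^ 2) =
      fun k : ℤ ↦
      (weilMellin (fun t ↦ h t * cexp (-(γ₀ * I) * t))
          (1 / 2 + (0 : ℝ) + ((γ₀ + 2 * π * k / T : ℝ) : ℂ) * I) *
        conj (weilMellin (fun t ↦ h t * cexp (-(γ₀ * I) * t))
          (1 - conj (1 / 2 + (0 : ℝ) + ((γ₀ + 2 * π * k / T : ℝ) : ℂ) * I)))).re := by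
    ext k
    rw [one_sub_conj_half_add]
    simp only [neg_zero, Complex.ofReal_zero, add_zero]
    rw [Complex.mul_conj, Complex.normSq_eq_norm_sq]
    norm_cast
  rw [e]
  exact H

/-- **Fence invisibility (pair blocks).** The pair blocks of the fence in `Z − D/2` sum to
`2T·∫|h|²`, whatever the common offset `u`:
`Σ_k (|ĝ(ρ_k)|² + |ĝ(ρ_k*)|² − |ĝ(ρ_k) − ĝ(ρ_k*)|²) = 2T‖h‖₂²`. -/
theorem hasSum_pairBlock_fence (hh : Continuous h) (hsupp : tsupport h ⊆ Icc (-a) a)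
    (hT : 0 < T) (haT : 2 * a < T) (u γ₀ : ℝ) :
    HasSum (fun k : ℤ ↦
      ‖weilMellin (fun t ↦ h t * cexp (-(γ₀ * I) * t))
          (1 / 2 + u + ((γ₀ + 2 * π * k / T : ℝ) : ℂ) * I)‖ ^ 2 +
        ‖weilMellin (fun t ↦ h t * cexp (-(γ₀ * I) * t))
          (1 - conj (1 / 2 + u + ((γ₀ + 2 * π * k / T : ℝ) : ℂ) * I))‖ ^ 2 -
        ‖weilMellin (fun t ↦ h t * cexp (-(γ₀ * I) * t))
            (1 / 2 + u + ((γ₀ + 2 * π * k / T : ℝ) : ℂ) * I) -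
          weilMellin (fun t ↦ h t * cexp (-(γ₀ * I) * t))
            (1 - conj (1 / 2 + u + ((γ₀ + 2 * π * k / T : ℝ) : ℂ) * I))‖ ^ 2)
      (2 * (T * ∫ t : ℝ, ‖h t‖ ^ 2)) := by
  have H := (hasSum_re_weilMellin_pair_fence hh hsupp hT haT u γ₀).mul_left 2
  have e : (fun k : ℤ ↦
      ‖weilMellin (fun t ↦ h t * cexp (-(γ₀ * I) * t))
          (1 / 2 + u + ((γ₀ + 2 * π * k / T : ℝ) : ℂ) * I)‖ ^ 2 +
        ‖weilMellin (fun t ↦ h t * cexp (-(γ₀ * I) * t))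
          (1 - conj (1 / 2 + u + ((γ₀ + 2 * π * k / T : ℝ) : ℂ) * I))‖ ^ 2 -
        ‖weilMellin (fun t ↦ h t * cexp (-(γ₀ * I) * t))
            (1 / 2 + u + ((γ₀ + 2 * π * k / T : ℝ) : ℂ) * I) -
          weilMellin (fun t ↦ h t * cexp (-(γ₀ * I) * t))
            (1 - conj (1 / 2 + u + ((γ₀ + 2 * π * k / T : ℝ) : ℂ) * I))‖ ^ 2) =
      fun k : ℤ ↦ 2 *
        (weilMellin (fun t ↦ h t * cexp (-(γ₀ * I) * t))
            (1 / 2 + u + ((γ₀ + 2 * π * k / T : ℝ) : ℂ) * I) *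
          conj (weilMellin (fun t ↦ h t * cexp (-(γ₀ * I) * t))
            (1 - conj (1 / 2 + u + ((γ₀ + 2 * π * k / T : ℝ) : ℂ) * I)))).re :=
    funext fun k ↦ norm_sq_add_norm_sq_sub_norm_sq_sub _ _
  rw [e]
  exact H

/-- **Fence invisibility (comparison with double critical zeros).** For every window-`a` test
`g = h·e^{−iγ₀t}` with `2a < T` and every offset `u`, the pair blocks of the fence
`{½ ± u + i(γ₀ + 2πk/T)}` sum to exactly twice the critical-line sum `Σ_k |ĝ(½ + i(γ₀ + 2πk/T))|²`:
in `Z − D/2` the fence is indistinguishable from double critical zeros at the same heights. -/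
theorem tsum_pairBlock_fence_eq_two_mul_tsum_critical (hh : Continuous h)
    (hsupp : tsupport h ⊆ Icc (-a) a) (hT : 0 < T) (haT : 2 * a < T) (u γ₀ : ℝ) :
    (∑' k : ℤ,
      (‖weilMellin (fun t ↦ h t * cexp (-(γ₀ * I) * t))
          (1 / 2 + u + ((γ₀ + 2 * π * k / T : ℝ) : ℂ) * I)‖ ^ 2 +
        ‖weilMellin (fun t ↦ h t * cexp (-(γ₀ * I) * t))
          (1 - conj (1 / 2 + u + ((γ₀ + 2 * π * k / T : ℝ) : ℂ) * I))‖ ^ 2 -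
        ‖weilMellin (fun t ↦ h t * cexp (-(γ₀ * I) * t))
            (1 / 2 + u + ((γ₀ + 2 * π * k / T : ℝ) : ℂ) * I) -
          weilMellin (fun t ↦ h t * cexp (-(γ₀ * I) * t))
            (1 - conj (1 / 2 + u + ((γ₀ + 2 * π * k / T : ℝ) : ℂ) * I))‖ ^ 2)) =
      2 * ∑' k : ℤ, ‖weilMellin (fun t ↦ h t * cexp (-(γ₀ * I) * t))
          (1 / 2 + ((γ₀ + 2 * π * k / T : ℝ) : ℂ) * I)‖ ^ 2 := by
  rw [(hasSum_pairBlock_fence hh hsupp hT haT u γ₀).tsum_eq,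
    (hasSum_norm_sq_weilMellin_fence hh hsupp hT haT γ₀).tsum_eq]

end Fence

end Summit.RiemannHypothesis.RiemannHypothesis.Theorems
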